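import Summits.MatrixMultiplication.MatrixMultiplication.Theorems.FarEdgeDescentSignTwistLeaf
import HarnessLib

/-!
# The sign-twist dictionary, II: the generic non-transpose twists of `⟨2,2,2⟩` are weight twists

Route `FarEdgeDescent` (cell `decomp-mm`, lens 2 «structural dichotomy (special vs generic)»,
gen 32), Kernel VII part 3b; support for the aside `SubLogRate` (stmt-MatrixMultiplication-25371).

With the leaf identities of `FarEdgeDescentSignTwistLeaf.lean` (characteristic `≠ 2`):

* `signStar_iso_permStar_Trd`, `signStar_iso_permStar_Tcd`: `𝔖_{T_rd} ≅ 𝔖_{T_cd} ≅ 𝔖^♭`, the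
  sign star `(X,(y,y')) ↦ (Xy, X^♭y')`, `X^♭ = sgn ∘ X` (restriction both ways; substitutions
  `X ↦ XQ`, `y, y' ↦ Q⁻¹y, Q⁻¹y'`, `Q = [[1,1],[-1,1]]`, from `T_rd(X)·Q = (XQ)^♭`, resp.
  `X ↦ QᵀX`, `z ↦ Q⁻¹z`, `z' ↦ DQ⁻¹z'`, `y' ↦ Dy'`, `D = diag(1,-1)`);
* `signTStar_iso_permStar_C3`: `𝔖_{C₃} ≅ 𝔖^{♭ᵀ}`, the transposed sign star
  `(X,(y,y')) ↦ (Xy, (X^♭)ᵀy')` (from `C₃(X) = T_rd(X)ᵀ`); `permStar_Trd_iso_permStar_Tcd`;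
* consequences transported along the dictionary (`Trd`, `Tcd`, `C3` are not product
  permutations, Kernel VI): for every `N ≥ 1`, `⟨2,2,2⟩^{⊠N}` and `(𝔖^♭)^{⊠N}` (resp.
  `(𝔖^{♭ᵀ})^{⊠N}`) are restriction-incomparable, and `⟨2,2,2⟩^{⊠N}` degenerates to neither
  (`matMul_pow_incomparable_signStar_pow`, `matMul_pow_not_algDegeneratesTo_signStar_pow`, …);
  `generic_classes_dichotomy` bundles the `n = 2` picture with part 1
  (`𝔖_2(1)^{⊠N} ⋭ (𝔖^♭)^{⊠N}, (𝔖^{♭ᵀ})^{⊠N}`) and Kernel VI (`⟨2,2,2⟩^{⊠N} ⋭ 𝔖_2(1)^{⊠N}`).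

So the generic stratum of the twists of `⟨2,2,2⟩` is, up to isomorphism, {transpose twist, sign
twist, sign-and-transpose twist} — the weight world of Cohn–Umans' `s`-rank: the weighted leaf of
`𝔖^♭` is the rank-`7` tensor `⟨2,2,2⟩_{-1}` of Bläser–Christandl–Zuiddam.

References: H. Cohn, C. Umans, SODA 2013, §3 [CohnUmans2013]; M. Bläser, M. Christandl, J. Zuiddam,
Chic. J. TCS 2018, Lemma 3, Def. 5 [BlaserChristandlZuiddam2017]; P. Bürgisser, M. Clausen,
M. A. Shokrollahi, *Algebraic Complexity Theory* (1997), §14.2, (15.19) [BurgisserClausenShokrollahi1997].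
-/

noncomputable section

open scoped BigOperators

set_option linter.dupNamespace false

namespace Summit.MatrixMultiplication.MatrixMultiplication.Theorems.FarEdgeDescentSignTwist

open Literature.Computability.AlgebraicComplexity
open Summit.MatrixMultiplication.MatrixMultiplication.Theorems.FarEdgeDescentTwistedStar
open Summit.MatrixMultiplication.MatrixMultiplication.Theorems.FarEdgeDescentTwistRigidity

universe u

/-! ## The dictionary -/

section Dictionary
variable (K : Type u) [Field K]

/-- **`𝔖^♭ ≅ 𝔖_{T_rd}`** (restriction both ways; characteristic `≠ 2`). [cite: CohnUmans2013, §3] -/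
theorem signStar_iso_permStar_Trd (h2 : (2 : K) ≠ 0) :
    TensorRestrictsTo (signStar K) (permStar K 2 1 Trd) ∧
      TensorRestrictsTo (permStar K 2 1 Trd) (signStar K) := by
  constructor
  · have h := starGlue_sub_restrictsTo (mm K) (mmSgn K) (liftMat K (one₂ K)) (liftMat K (one₂ K))
      (colSub K (Qm K)) (liftMat K (Qi K)) (liftMat K (Qi K))
    rw [leaf_col_Q_Qi h2, leaf_Trd_from_sgn h2] at h
    rwa [signStar_eq_starGlue, permStar_eq_starGlue]
  · have h := starGlue_sub_restrictsTo (mm K) (mmPerm K Trd) (liftMat K (one₂ K))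
      (liftMat K (one₂ K)) (colSub K (Qi K)) (liftMat K (Qm K)) (liftMat K (Qm K))
    rw [leaf_col_Qi_Q h2, leaf_sgn_from_Trd h2] at h
    rwa [signStar_eq_starGlue, permStar_eq_starGlue]

/-- **`𝔖^♭ ≅ 𝔖_{T_cd}`** (restriction both ways; characteristic `≠ 2`). [cite: CohnUmans2013, §3] -/
theorem signStar_iso_permStar_Tcd (h2 : (2 : K) ≠ 0) :
    TensorRestrictsTo (signStar K) (permStar K 2 1 Tcd) ∧
      TensorRestrictsTo (permStar K 2 1 Tcd) (signStar K) := by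
  constructor
  · have h := starGlue_sub_restrictsTo (mm K) (mmSgn K) (liftMat K (Qi K)) (liftMat K (dQi K))
      (rowSub K (Qm K)) (liftMat K (one₂ K)) (liftMat K (dMat K))
    rw [leaf_row_Q_Qi h2, leaf_Tcd_from_sgn h2] at h
    rwa [signStar_eq_starGlue, permStar_eq_starGlue]
  · have h := starGlue_sub_restrictsTo (mm K) (mmPerm K Tcd) (liftMat K (Qm K)) (liftMat K (Qd K))
      (rowSub K (Qi K)) (liftMat K (one₂ K)) (liftMat K (dMat K))
    rw [leaf_row_Qi_Q h2, leaf_sgn_from_Tcd h2] at h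
    rwa [signStar_eq_starGlue, permStar_eq_starGlue]

/-- **`𝔖^{♭ᵀ} ≅ 𝔖_{C₃}`** (restriction both ways; characteristic `≠ 2`). [cite: CohnUmans2013, §3] -/
theorem signTStar_iso_permStar_C3 (h2 : (2 : K) ≠ 0) :
    TensorRestrictsTo (signTStar K) (permStar K 2 1 C3) ∧
      TensorRestrictsTo (permStar K 2 1 C3) (signTStar K) := by
  constructor
  · have h := starGlue_sub_restrictsTo (mm K) (mmSgnT K) (liftMat K (one₂ K)) (liftMat K (Qi K))
      (colSub K (Qm K)) (liftMat K (Qi K)) (liftMat K (one₂ K))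
    rw [leaf_col_Q_Qi h2, leaf_C3_from_sgnT h2] at h
    rwa [signTStar_eq_starGlue, permStar_eq_starGlue]
  · have h := starGlue_sub_restrictsTo (mm K) (mmPerm K C3) (liftMat K (one₂ K)) (liftMat K (Qm K))
      (colSub K (Qi K)) (liftMat K (Qm K)) (liftMat K (one₂ K))
    rw [leaf_col_Qi_Q h2, leaf_sgnT_from_C3 h2] at h
    rwa [signTStar_eq_starGlue, permStar_eq_starGlue]

/-- `𝔖_{T_rd} ≅ 𝔖_{T_cd}`: the two halves of the class `♭` are isomorphic. [folklore] -/
theorem permStar_Trd_iso_permStar_Tcd (h2 : (2 : K) ≠ 0) :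
    TensorRestrictsTo (permStar K 2 1 Trd) (permStar K 2 1 Tcd) ∧
      TensorRestrictsTo (permStar K 2 1 Tcd) (permStar K 2 1 Trd) :=
  ⟨(signStar_iso_permStar_Trd K h2).2.trans (signStar_iso_permStar_Tcd K h2).1,
    (signStar_iso_permStar_Tcd K h2).2.trans (signStar_iso_permStar_Trd K h2).1⟩

end Dictionary

/-! ## Transport along the dictionary: `⟨2,2,2⟩` versus the sign classes, every power -/

section Transport
variable (K : Type u) [Field K]

/-- **`⟨2,2,2⟩^{⊠N}` and `(𝔖^♭)^{⊠N}` are restriction-incomparable** (`N ≥ 1`, char `≠ 2`):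
Kernel VI for the generic `T_rd`, transported. [cite: BurgisserClausenShokrollahi1997, §14.2] -/
theorem matMul_pow_incomparable_signStar_pow (h2 : (2 : K) ≠ 0) (N : ℕ) (hN : 1 ≤ N) :
    ¬ TensorRestrictsTo (kroneckerPow (matMulTensor K 2 2 (1 + 1)) N) (kroneckerPow (signStar K) N) ∧
      ¬ TensorRestrictsTo (kroneckerPow (signStar K) N)
        (kroneckerPow (matMulTensor K 2 2 (1 + 1)) N) := by
  obtain ⟨hst, hts⟩ := signStar_iso_permStar_Trd K h2
  refine ⟨fun h => not_isProdPerm_Trd ?_, fun h => not_isProdPerm_Trd ?_⟩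
  · exact (matMul_pow_restrictsTo_permStar_pow_iff (K := K) Trd le_rfl hN).1
      (h.trans (hst.kroneckerPow N))
  · exact (permStar_pow_restrictsTo_matMul_pow_iff (K := K) Trd le_rfl hN).1
      ((hts.kroneckerPow N).trans h)

/-- **`⟨2,2,2⟩^{⊠N}` and `(𝔖^{♭ᵀ})^{⊠N}` are restriction-incomparable** (`N ≥ 1`, char `≠ 2`).
[cite: BurgisserClausenShokrollahi1997, §14.2] -/
theorem matMul_pow_incomparable_signTStar_pow (h2 : (2 : K) ≠ 0) (N : ℕ) (hN : 1 ≤ N) :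
    ¬ TensorRestrictsTo (kroneckerPow (matMulTensor K 2 2 (1 + 1)) N)
        (kroneckerPow (signTStar K) N) ∧
      ¬ TensorRestrictsTo (kroneckerPow (signTStar K) N)
        (kroneckerPow (matMulTensor K 2 2 (1 + 1)) N) := by
  obtain ⟨hst, hts⟩ := signTStar_iso_permStar_C3 K h2
  refine ⟨fun h => not_isProdPerm_C3 ?_, fun h => not_isProdPerm_C3 ?_⟩
  · exact (matMul_pow_restrictsTo_permStar_pow_iff (K := K) C3 le_rfl hN).1
      (h.trans (hst.kroneckerPow N))
  · exact (permStar_pow_restrictsTo_matMul_pow_iff (K := K) C3 le_rfl hN).1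
      ((hts.kroneckerPow N).trans h)

/-- **`⟨2,2,2⟩^{⊠N} ⋭ (𝔖^♭)^{⊠N}`** (`N ≥ 1`, char `≠ 2`): the special leaf degenerates to no
power of the sign twist. [cite: BurgisserClausenShokrollahi1997, (15.19)] -/
theorem matMul_pow_not_algDegeneratesTo_signStar_pow (h2 : (2 : K) ≠ 0) (N : ℕ) (hN : 1 ≤ N) :
    ¬ AlgDegeneratesTo (kroneckerPow (matMulTensor K 2 2 (1 + 1)) N)
      (kroneckerPow (signStar K) N) := fun h =>
  not_isProdPerm_Trd ((matMul_pow_algDegeneratesTo_permStar_pow_iff (K := K) Trd le_rfl hN).1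
    (h.trans_restrictsTo ((signStar_iso_permStar_Trd K h2).1.kroneckerPow N)))

/-- **`⟨2,2,2⟩^{⊠N} ⋭ (𝔖^{♭ᵀ})^{⊠N}`** (`N ≥ 1`, char `≠ 2`). [cite: BurgisserClausenShokrollahi1997, (15.19)] -/
theorem matMul_pow_not_algDegeneratesTo_signTStar_pow (h2 : (2 : K) ≠ 0) (N : ℕ) (hN : 1 ≤ N) :
    ¬ AlgDegeneratesTo (kroneckerPow (matMulTensor K 2 2 (1 + 1)) N)
      (kroneckerPow (signTStar K) N) := fun h =>
  not_isProdPerm_C3 ((matMul_pow_algDegeneratesTo_permStar_pow_iff (K := K) C3 le_rfl hN).1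
    (h.trans_restrictsTo ((signTStar_iso_permStar_C3 K h2).1.kroneckerPow N)))

/-- **The special/generic dichotomy at `n = 2`, in one statement** (`N ≥ 1`, char `≠ 2`): the
three generic classes `ᵀ = 𝔖_2(1)`, `♭ = 𝔖^♭`, `♭ᵀ = 𝔖^{♭ᵀ}` are each restriction-incomparable
with `⟨2,2,2⟩` at the `N`-th power, `⟨2,2,2⟩^{⊠N}` degenerates to none of them, and `𝔖_2(1)^{⊠N}`
degenerates to neither sign class. [cite: BurgisserClausenShokrollahi1997, §14.2, (15.19)] -/
theorem generic_classes_dichotomy (h2 : (2 : K) ≠ 0) (N : ℕ) (hN : 1 ≤ N) :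
    (¬ TensorRestrictsTo (kroneckerPow (matMulTensor K 2 2 (1 + 1)) N)
        (kroneckerPow (signStar K) N) ∧
      ¬ TensorRestrictsTo (kroneckerPow (signStar K) N)
        (kroneckerPow (matMulTensor K 2 2 (1 + 1)) N)) ∧
    (¬ TensorRestrictsTo (kroneckerPow (matMulTensor K 2 2 (1 + 1)) N)
        (kroneckerPow (signTStar K) N) ∧
      ¬ TensorRestrictsTo (kroneckerPow (signTStar K) N)
        (kroneckerPow (matMulTensor K 2 2 (1 + 1)) N)) ∧
    ¬ AlgDegeneratesTo (kroneckerPow (matMulTensor K 2 2 (1 + 1)) N)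
        (kroneckerPow (twistedStar K 2 1) N) ∧
    ¬ AlgDegeneratesTo (kroneckerPow (matMulTensor K 2 2 (1 + 1)) N)
        (kroneckerPow (signStar K) N) ∧
    ¬ AlgDegeneratesTo (kroneckerPow (matMulTensor K 2 2 (1 + 1)) N)
        (kroneckerPow (signTStar K) N) ∧
    ¬ AlgDegeneratesTo (kroneckerPow (twistedStar K 2 1) N) (kroneckerPow (signStar K) N) ∧
    ¬ AlgDegeneratesTo (kroneckerPow (twistedStar K 2 1) N) (kroneckerPow (signTStar K) N) :=
  ⟨matMul_pow_incomparable_signStar_pow K h2 N hN, matMul_pow_incomparable_signTStar_pow K h2 N hN,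
    by
      rw [← permStar_prodComm]
      exact fun h => (not_isProdPerm_prodComm (n := 2) (by norm_num))
        ((matMul_pow_algDegeneratesTo_permStar_pow_iff (K := K) _ le_rfl hN).1 h),
    matMul_pow_not_algDegeneratesTo_signStar_pow K h2 N hN,
    matMul_pow_not_algDegeneratesTo_signTStar_pow K h2 N hN,
    twistedStar_pow_not_algDegeneratesTo_signStar N hN,
    twistedStar_pow_not_algDegeneratesTo_signTStar h2 N hN⟩

end Transport

end Summit.MatrixMultiplication.MatrixMultiplication.Theorems.FarEdgeDescentSignTwist

end
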